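import Summits.HodgeConjecture.HodgeConjecture.Theorems.Ring2AbelianAllWeilBaseChangeProduct
import Summits.HodgeConjecture.HodgeConjecture.Theorems.WeilTypeLadderOnPath
import Literature.AlgebraicGeometry.HodgeTheory.AbelianVarietyPullbackAlgebraicClasses
import Literature.AlgebraicGeometry.HodgeTheory.HodgeTypeExteriorProduct
import Literature.AlgebraicGeometry.HodgeTheory.HodgeTypeConjugation
import Literature.AlgebraicGeometry.HodgeTheory.ComplexConjugationHolds
import Literature.AlgebraicGeometry.HodgeTheory.SupportedClassesRational
import Literature.AlgebraicGeometry.Motives.HyperbolicWeilTypeProduct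
import HarnessLib

/-!
# Ring 2 · AbelianAll (ab-weil-1, gen 139, part BC-c) — LEMMA BC in the kernel:
  `WeilBaseChangeRestriction` holds, and rung R3 ⟹ rung R∞ ⟹ R1 / R1′ / R2 by base change

research route conditional on HC_CM; not a corollary; Q11.4-sentence-2 already refuted in dim ≥ 3.
`HC_CM` (`Theses.RankFourFaces.CMAbelianHodge`) does not occur in this file and NO open case of the Hodge
conjecture is claimed: every pay-off below is an implication between NAMED OPEN rungs of
`Theorems/WeilTypeLadder` (`WeilClassesCMField` = R3, `WeilClassesImaginaryQuadratic` = R∞, `WeilSixfolds` = R1,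
`NonsplitSixfolds` = R1′, `SplitWeilAbelianVarieties` = R2). What IS proved unconditionally is the pen-and-paper
hypothesis LEMMA BC of the memo `pub/vhodge/memos/ROUTE-P2-g3.md` (typed companion `ROUTE-P2-g3-Sketch.lean`,
whose two definitions `IsCMQuartic`, `WeilBaseChangeRestriction` are copied VERBATIM in §2), so that the memo's
edge "R3 ⟹ R∞ by RESTRICTION" (bears on H2 → H1) now carries NO extra binder: the binder `hBC` is the theorem
`weilBaseChangeRestriction_holds` and Fulton's pull-back record `hF` is discharged by the tree's fact-free
`map_mem_algebraicClasses_of_abelianVariety` (pull-back along a morphism to an abelian variety).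

## What is proved (0 sorry)

* §1 THE LIFT. For `B = A × A` and rational weights `r₀, …, r_{2n}`, `L_r := Σ_m r_m · g_m^*`,
  `g_m = p₁ + m • p₂ : B ⟶ A` (`bcLift`): `i^* ∘ L_r = (Σ r_m) · id` for `i = (𝟙, 0)` (`map_bcIncl_bcLift`);
  `L_r` preserves rational classes (`isRationalClass_bcLift`) and Hodge type (`isOfHodgeType_bcLift`); and — the
  point — if `Σ_m r_m m^k = e_k := ((√2)^k + (−√2)^k)/2` for `k ≤ 2n` (such RATIONAL weights exist, Vandermonde),
  then for `a₁, …, a_{2n}` in an eigenspace `V_ν` of `φ^*`, `ν² = −d`,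
  `L_r(∏ aᵢ) = Σ_s e_{|sᶜ|} τ_s(a) = ½ (w_{√2}(a) + w_{−√2}(a)) ∈ W_E(B) = weilClassesField B θ P_d (2n)`
  (`bcLift_cupPowOne_eq`, `baseChange_add_baseChange_neg`, `bcLift_cupPowOne_mem_weilClassesField`).
* §2 `IsCMQuartic`, `WeilBaseChangeRestriction` VERBATIM from the sketch; `isCMQuartic_bcQuartic` (part BC-a);
  **`weilBaseChangeRestriction_holds : WeilBaseChangeRestriction`** with the witnesses `P = P_d = bcQuartic d`
  (`E = K(√2)`), `B = A.prod A`, `θ = bcTheta φ`, `i = bcIncl A`, `c' = L_r c`: every class of the Weil plane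
  `weilClassesOf A φ n d = ℂα ⊔ ℂβ` (part BC-b §4) lifts, rationally and of type `(n, n)`, into `W_E(B)` with
  `i^* c' = c` (`Σ r_m = e₀ = 1`).
* §3 PAY-OFFS, no extra binder: `WeilClassesCMField → WeilClassesImaginaryQuadratic`
  (`weilClassesImaginaryQuadratic_of_weilClassesCMField`), hence `→ WeilSixfolds` (item stmt-HodgeConjecture-2524),
  `→ NonsplitSixfolds`, `→ SplitWeilAbelianVarieties` (the tree's `WeilTypeLadderOnPath` arrows out of R∞).

What is NOT proved or claimed: no rung of the ladder; `B = A ⊗_K E` being of split `E`-Weil type (memo §2.3,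
LEMMA HYP) is not typed here; no Literature fact is introduced; no internally-minted statement is cited as a fact.

## References

* [vanGeemen1994HodgeAV] B. van Geemen, An introduction to the Hodge conjecture for abelian varieties,
  LNM 1594 (1994), 4.9–4.12, proof of Thm. 6.12.
* [MoonenZarhin1998WeilClasses] B. Moonen, Yu. Zarhin, Weil classes on abelian varieties,
  J. reine angew. Math. 496 (1998), §1.
* [Markman2025SurveySecant] E. Markman, arXiv:2509.23403, §12 p. 20 ("… as well as for CM-fields `K` with
  `[K : ℚ] > 2`").
* [FultonIntersectionTheory1998] W. Fulton, Intersection theory, 2nd ed. (1998), Prop. 8.3 (a), Cor. 19.2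
  (pull-back of algebraic classes; here via `map_mem_algebraicClasses_of_abelianVariety`).
-/

noncomputable section

set_option linter.dupNamespace false

open CategoryTheory
open scoped BigOperators
open Literature.AlgebraicGeometry Literature.AlgebraicGeometry.Motives
open Literature.AlgebraicGeometry.HodgeTheory
open Literature.AlgebraicTopology.SingularHomology
open Summit.HodgeConjecture.HodgeConjecture.WeilTypeLadder

namespace Summit.HodgeConjecture.HodgeConjecture.Ring2.AbelianAll

variable {A : AbelianVariety ℂ} {d : ℕ}

/-! ### §1 The lift `L_r = Σ_m r_m · g_m^*` -/

section Lift

variable (A) in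
/-- The lift `L_r := Σ_m r_m · g_m^* : Hᵏ(A; ℂ) → Hᵏ(A × A; ℂ)`, `g_m = p₁ + m • p₂`, for rational weights `r`. -/
def bcLift {N : ℕ} (r : Fin N → ℚ) (k : ℕ) : complexBetti A.X k →ₗ[ℂ] complexBetti (A.prod A).X k :=
  ∑ m : Fin N, ((r m : ℚ) : ℂ) • (complexBetti.map (bcProj A (m : ℕ)).hom.hom.hom k).hom

/-- Unfolding of the lift `L_r`. -/
theorem bcLift_apply {N : ℕ} (r : Fin N → ℚ) (k : ℕ) (c : complexBetti A.X k) :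
    bcLift A r k c = ∑ m : Fin N, ((r m : ℚ) : ℂ) • complexBetti.map (bcProj A (m : ℕ)).hom.hom.hom k c := by
  rw [bcLift, LinearMap.sum_apply]
  rfl

/-- `i^*(L_r c) = (Σ_m r_m) · c`. -/
theorem map_bcIncl_bcLift {N : ℕ} (r : Fin N → ℚ) (k : ℕ) (c : complexBetti A.X k) :
    complexBetti.map (bcIncl A).hom.hom.hom k (bcLift A r k c) = (∑ m : Fin N, ((r m : ℚ) : ℂ)) • c := by
  rw [bcLift_apply, map_sum, Finset.sum_smul]
  refine Finset.sum_congr rfl fun m _ => ?_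
  rw [map_smul, map_bcIncl_map_bcProj]

/-- `L_r` carries rational classes to rational classes (rational combination of pull-backs). -/
theorem isRationalClass_bcLift {N : ℕ} (r : Fin N → ℚ) (k : ℕ) {c : complexBetti A.X k}
    (hc : IsRationalClass c) : IsRationalClass (bcLift A r k c) := by
  rw [bcLift_apply]
  exact IsRationalClass.sum_smul _ (fun m => hc.pullback _) r

/-- `L_r` carries classes of type `(p, q)` on `A` to classes of type `(p, q)` on `A × A`. -/
theorem isOfHodgeType_bcLift {N : ℕ} (r : Fin N → ℚ) {m k p q : ℕ} (hA : IsSmoothProjective m A.X)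
    {c : complexBetti A.X k} (hc : IsOfHodgeType m A.X k p q c) :
    IsOfHodgeType (A.prod A).dim (A.prod A).X k p q (bcLift A r k c) := by
  have hB : IsSmoothProjective (A.prod A).dim (A.prod A).X := AbelianVariety.isSmoothProjective_holds
  rw [bcLift_apply]
  exact IsOfHodgeType.sum hB (nonempty_hodgeModel_holds hB).some _ _
    (fun j _ => (hc.map_of_isSmoothProjective hB hA _).smul _)

/-- **`L_r(∏ aᵢ) = Σ_s e_{|sᶜ|} τ_s(a)`** for weights with power sums `Σ_m r_m m^j = e_j` (`j < N`, `k < N`). -/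
theorem bcLift_cupPowOne_eq {N k : ℕ} {r : Fin N → ℚ} {e : ℕ → ℚ}
    (hr : ∀ j < N, ∑ m : Fin N, r m * (m : ℚ) ^ j = e j) (hk : k < N) (a : Fin k → complexBetti A.X 1) :
    bcLift A r k (cupPowOne ℂ (ComplexPoints A.X) k a) =
      ∑ s : Finset (Fin k), ((e sᶜ.card : ℚ) : ℂ) • bcTau a s := by
  classical
  rw [bcLift_apply]
  trans ∑ m : Fin N, ∑ s : Finset (Fin k), (((r m : ℚ) : ℂ) * ((m : ℕ) : ℂ) ^ sᶜ.card) • bcTau a s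
  · refine Finset.sum_congr rfl fun m _ => ?_
    rw [map_bcProj_cupPowOne, Finset.smul_sum]
    refine Finset.sum_congr rfl fun s _ => ?_
    rw [smul_smul]
  rw [Finset.sum_comm]
  refine Finset.sum_congr rfl fun s _ => ?_
  rw [← Finset.sum_smul]
  congr 1
  have hs : sᶜ.card < N :=
    lt_of_le_of_lt (Finset.card_le_univ _) (by rw [Fintype.card_fin]; exact hk)
  rw [← hr _ hs]
  push_cast
  rfl

/-- **`w_{√2}(a) + w_{−√2}(a) = 2 · Σ_s e_{|sᶜ|} τ_s(a)`** (`(√2)^j + (−√2)^j = 2 e_j`). -/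
theorem baseChange_add_baseChange_neg {k : ℕ} (a : Fin k → complexBetti A.X 1) :
    cupPowOne ℂ (ComplexPoints (A.prod A).X) k
        (fun i => complexBetti.map (AbelianVariety.fst A A).hom.hom.hom 1 (a i) +
          ((Real.sqrt 2 : ℝ) : ℂ) • complexBetti.map (AbelianVariety.snd A A).hom.hom.hom 1 (a i)) +
      cupPowOne ℂ (ComplexPoints (A.prod A).X) k
        (fun i => complexBetti.map (AbelianVariety.fst A A).hom.hom.hom 1 (a i) +
          (-((Real.sqrt 2 : ℝ) : ℂ)) • complexBetti.map (AbelianVariety.snd A A).hom.hom.hom 1 (a i)) =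
      (2 : ℂ) • ∑ s : Finset (Fin k), ((evenPowWeight sᶜ.card : ℚ) : ℂ) • bcTau a s := by
  classical
  rw [cupPowOne_baseChange_eq_sum, cupPowOne_baseChange_eq_sum, ← Finset.sum_add_distrib, Finset.smul_sum]
  refine Finset.sum_congr rfl fun s _ => ?_
  rw [← add_smul, smul_smul, sqrt_two_pow_add_neg_pow]

/-- **`L_r(∏ aᵢ) ∈ W_E(B)`**: for the parity weights (`Σ_m r_m m^j = e_j`, `j ≤ 2n`) and `a₁, …, a_{2n} ∈ V_ν`,
`ν² = −d`, `L_r(∏ aᵢ) = ½ (w_{√2}(a) + w_{−√2}(a)) ∈ weilClassesField (A × A) θ P_d (2n)`. -/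
theorem bcLift_cupPowOne_mem_weilClassesField (φ : A ⟶ A) {n : ℕ} {r : Fin (2 * n + 1) → ℚ}
    (hr : ∀ j < 2 * n + 1, ∑ m : Fin (2 * n + 1), r m * (m : ℚ) ^ j = evenPowWeight j)
    {ν : ℂ} (hν : ν ^ 2 = -(d : ℂ)) {a : Fin (2 * n) → complexBetti A.X 1}
    (ha : ∀ i, a i ∈ Module.End.eigenspace (complexBetti.map φ.hom.hom.hom 1).hom ν) :
    bcLift A r (2 * n) (cupPowOne ℂ (ComplexPoints A.X) (2 * n) a) ∈
      weilClassesField (A.prod A) (bcTheta φ) (bcQuartic d) (2 * n) := by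
  classical
  have hσ : ((Real.sqrt 2 : ℝ) : ℂ) ^ 2 = 2 := by
    rw [← Complex.ofReal_pow, Real.sq_sqrt (by norm_num : (0 : ℝ) ≤ 2)]; push_cast; rfl
  have hσ' : (-((Real.sqrt 2 : ℝ) : ℂ)) ^ 2 = 2 := by rw [neg_sq, hσ]
  have hw := add_mem (cupPowOne_baseChange_mem_weilClassesField φ hν hσ ha)
    (cupPowOne_baseChange_mem_weilClassesField φ hν hσ' ha)
  rw [baseChange_add_baseChange_neg] at hw
  rw [bcLift_cupPowOne_eq hr (Nat.lt_succ_self _)]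
  have h2 := Submodule.smul_mem _ (2 : ℂ)⁻¹ hw
  rwa [smul_smul, inv_mul_cancel₀ two_ne_zero, one_smul] at h2

end Lift

/-! ### §2 LEMMA BC: the statements (verbatim from `ROUTE-P2-g3-Sketch.lean`) and the proof -/

section Statement

/-- The arithmetic hypotheses of rung R3 (`WeilClassesCMField`) at a quartic `P`: monic, degree `4`,
irreducible over `ℚ`, no real root, one `Q ∈ ℚ[T]` inducing complex conjugation on all roots (CM field). -/
def IsCMQuartic (P : Polynomial ℤ) : Prop :=
  P.Monic ∧ P.natDegree = 4 ∧ Irreducible (P.map (Int.castRingHom ℚ)) ∧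
    (∀ ρ : ℂ, Polynomial.eval₂ (Int.castRingHom ℂ) ρ P = 0 → starRingEnd ℂ ρ ≠ ρ) ∧
    (∃ Q : Polynomial ℚ, ∀ ρ : ℂ, Polynomial.eval₂ (Int.castRingHom ℂ) ρ P = 0 →
        Polynomial.eval₂ (algebraMap ℚ ℂ) ρ Q = starRingEnd ℂ ρ)

/-- **LEMMA BC (base change and restriction of Weil classes).** For every complex abelian `2n`-fold `A`
(`n ≥ 1`) with `φ ≫ φ = -(d • 𝟙 A)`, `d ≥ 1` (any discriminant), there are a CM quartic `P`, an abelian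
`4n`-fold `B` with `θ : B ⟶ B`, `P(θ) = 0`, and a morphism `i : A ⟶ B` such that every rational `(n,n)` class
of the Weil plane `weilClassesOf A φ n d` is `i^*` of a rational `(n,n)` class of `weilClassesField B θ P (2n)`. -/
def WeilBaseChangeRestriction : Prop :=
  ∀ (n d : ℕ), 1 ≤ n → 0 < d → ∀ (A : AbelianVariety ℂ) (φ : A ⟶ A), A.dim = 2 * n →
    φ ≫ φ = -(d • 𝟙 A) →
    ∃ (P : Polynomial ℤ) (B : AbelianVariety ℂ) (θ : B ⟶ B) (i : A.X ⟶ B.X),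
      IsCMQuartic P ∧
      Polynomial.eval₂ (Int.castRingHom (CategoryTheory.End B)) (θ : CategoryTheory.End B) P = 0 ∧
      B.dim = 4 * n ∧
      ∀ c : complexBetti A.X (2 * n), IsRationalClass c → IsOfHodgeType (2 * n) A.X (2 * n) n n c →
        c ∈ weilClassesOf A φ n d →
        ∃ c' : complexBetti B.X (2 * n), c' ∈ weilClassesField B θ P (2 * n) ∧ IsRationalClass c' ∧
          IsOfHodgeType B.dim B.X (2 * n) n n c' ∧ complexBetti.map i (2 * n) c' = c

/-- **`P_d` is a CM quartic** for every `d ≥ 1` (part BC-a). -/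
theorem isCMQuartic_bcQuartic (d : ℕ) (hd : 0 < d) : IsCMQuartic (bcQuartic d) :=
  ⟨bcQuartic_monic d, bcQuartic_natDegree d, bcQuartic_irreducible d hd,
    fun _ hρ => conj_ne_self_of_bcQuartic d hd hρ, exists_conjPolynomial_bcQuartic d⟩

/-- **Every class of the Weil plane lifts into `W_E(A × A)`** along `L_r` (parity weights `r`):
`weilClassesOf A φ n d = ℂα ⊔ ℂβ` with `α = ∏ aᵢ`, `β = ∏ bⱼ` top wedges of eigenbases of `V±`, and
`L_r α, L_r β ∈ W_E` (`bcLift_cupPowOne_mem_weilClassesField` at `ν = ±i√d`). -/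
theorem bcLift_mem_weilClassesField_of_mem_weilClassesOf (φ : A ⟶ A) {n : ℕ} (hA : A.dim = 2 * n)
    (hd : 0 < d) (hφ : φ ≫ φ = -(d • 𝟙 A)) {r : Fin (2 * n + 1) → ℚ}
    (hr : ∀ j < 2 * n + 1, ∑ m : Fin (2 * n + 1), r m * (m : ℚ) ^ j = evenPowWeight j)
    {c : complexBetti A.X (2 * n)} (hcW : c ∈ weilClassesOf A φ n d) :
    bcLift A r (2 * n) c ∈ weilClassesField (A.prod A) (bcTheta φ) (bcQuartic d) (2 * n) := by
  classical
  obtain ⟨a, b, ha, hb, hα0, hβ0⟩ := exists_eigenbases φ hA hd hφ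
  have hΛ : HasExteriorCohomologyH1 ℂ (ComplexPoints A.X) :=
    AbelianVariety.hasExteriorCohomologyH1_complexPoints A
  have hb₁ : Module.finrank ℂ (complexBetti A.X 1) = 2 * (2 * n) := by
    rw [AbelianVariety.finrank_complexBetti_one, hA]
  have hαE := cupPowOne_mem_weilClassesPlus φ ha
  have hβE := cupPowOne_mem_weilClassesMinus φ hb
  obtain ⟨c₁, hc₁, c₂, hc₂, rfl⟩ := Submodule.mem_sup.mp hcW
  obtain ⟨t₁, rfl⟩ := Submodule.mem_span_singleton.mp
    (weilClassesPlus_le_span_singleton hΛ hb₁ hd hφ hαE hα0 hc₁)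
  obtain ⟨t₂, rfl⟩ := Submodule.mem_span_singleton.mp
    (weilClassesMinus_le_span_singleton hΛ hb₁ hd hφ hβE hβ0 hc₂)
  have hν : (Complex.I * (Real.sqrt d : ℂ)) ^ 2 = -(d : ℂ) := I_mul_sqrt_sq d
  have hν' : (-(Complex.I * (Real.sqrt d : ℂ))) ^ 2 = -(d : ℂ) := by rw [neg_sq, hν]
  rw [map_add, map_smul, map_smul]
  exact add_mem (Submodule.smul_mem _ _ (bcLift_cupPowOne_mem_weilClassesField φ hr hν ha))
    (Submodule.smul_mem _ _ (bcLift_cupPowOne_mem_weilClassesField φ hr hν' hb))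

/-- **LEMMA BC holds** — witnesses: `P = P_d` (`E = ℚ(√-d, √2)`), `B = A × A`, `θ = (φ × φ) + S`,
`i = (𝟙, 0)`, `c' = L_r c` for the parity weights `r` (`Σ r_m m^j = e_j`, `j ≤ 2n`; `Σ r_m = 1`). -/
theorem weilBaseChangeRestriction_holds : WeilBaseChangeRestriction := by
  intro n d _hn hd A φ hA hφ
  classical
  obtain ⟨r, hr⟩ := exists_rat_weights (2 * n + 1) evenPowWeight
  refine ⟨bcQuartic d, A.prod A, bcTheta φ, (bcIncl A).hom.hom.hom, isCMQuartic_bcQuartic d hd,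
    eval₂_bcTheta_bcQuartic φ hφ, by rw [AbelianVariety.dim_prod, hA]; ring, fun c hcrat hcH hcW => ?_⟩
  refine ⟨bcLift A r (2 * n) c, bcLift_mem_weilClassesField_of_mem_weilClassesOf φ hA hd hφ hr hcW,
    isRationalClass_bcLift r _ hcrat, isOfHodgeType_bcLift r (isSmoothProjective_of_dim_eq' hA) hcH, ?_⟩
  rw [map_bcIncl_bcLift]
  have h1 : (∑ m : Fin (2 * n + 1), ((r m : ℚ) : ℂ)) = 1 := by
    have h := hr 0 (Nat.succ_pos _)
    simp only [pow_zero, mul_one, evenPowWeight_zero] at h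
    exact_mod_cast h
  rw [h1, one_smul]

end Statement

/-! ### §3 Pay-offs: R3 ⟹ R∞ ⟹ R1 / R1′ / R2 by base change, no extra binder -/

section Payoff

/-- **R3 ⟹ R∞ by RESTRICTION (H2 → H1).** Rung `WeilClassesCMField` (Weil classes for CM fields of degree
`> 2`) implies Weil's question `WeilClassesImaginaryQuadratic` (every `n ≥ 2`, every `K = ℚ(√-d)`, every
discriminant): lift a Weil class of `A` to an `E`-Weil class of `B = A × A` (LEMMA BC, `E = K(√2)`), apply R3
on `B`, restrict along `i : A ⟶ B` (pull-back of algebraic classes, `map_mem_algebraicClasses_of_abelianVariety`). -/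
theorem weilClassesImaginaryQuadratic_of_weilClassesCMField (h₃ : WeilClassesCMField) :
    WeilClassesImaginaryQuadratic := by
  intro n hn d hd A φ hA hAsp hφ c hc hH hcW
  obtain ⟨P, B, θ, i, ⟨hmon, hdeg, hirr, hreal, hconj⟩, hθ, hB, hres⟩ :=
    weilBaseChangeRestriction_holds n d (by omega) hd A φ hA hφ
  obtain ⟨c', hc'W, hc'rat, hc'H, hc'eq⟩ := hres c hc hH hcW
  have halg : c' ∈ algebraicClasses B.X n :=
    h₃ B θ P 4 n hmon hdeg (by norm_num) hirr hθ (by rw [hB]; ring) hreal hconj c' hc'W hc'rat hc'H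
  rw [← hc'eq]
  exact map_mem_algebraicClasses_of_abelianVariety hAsp B i halg

/-- **R3 ⟹ R1 (ALL Weil sixfolds, item stmt-HodgeConjecture-2524) by base change.** -/
theorem weilSixfolds_of_weilClassesCMField (h₃ : WeilClassesCMField) :
    Theses.SevenfoldWeilCensus.WeilSixfolds :=
  weilSixfolds_of_weilClassesImaginaryQuadratic (weilClassesImaginaryQuadratic_of_weilClassesCMField h₃)

/-- **R3 ⟹ R1′ (NON-split Weil sixfolds) by base change.** -/
theorem nonsplitSixfolds_of_weilClassesCMField (h₃ : WeilClassesCMField) : NonsplitSixfolds :=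
  nonsplitSixfolds_of_weilClassesImaginaryQuadratic (weilClassesImaginaryQuadratic_of_weilClassesCMField h₃)

/-- **R3 ⟹ R2 (split Weil type, every `n ≥ 4`) by base change.** -/
theorem splitWeilAbelianVarieties_of_weilClassesCMField (h₃ : WeilClassesCMField) :
    SplitWeilAbelianVarieties :=
  splitWeilAbelianVarieties_of_weilClassesImaginaryQuadratic
    (weilClassesImaginaryQuadratic_of_weilClassesCMField h₃)

end Payoff

end Summit.HodgeConjecture.HodgeConjecture.Ring2.AbelianAll

end
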